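import Summits.Ventures.PercRepro.C041CycleZone

/-!
# ROW C-041 — THE CLASS WITH MARKED CYCLES: the cone class `IsZe` extended by the two-exit cycles with two marked
vertices as further seeds (p6, gen 31)

`IsZf` is the class of zones generated from the members of `IsZe` (`C041ConeClassE`: one-vertex zones, pendant
attachment, anchor gluing, stray vertices) AND THE MARKED CYCLES — every cycle `C_{n+1}` through the anchor
carrying two marked vertices of any marks (`C041CycleZone`: `inCone_sixVec_cyc2_point`) — by the same four
operations.  **Every member lies in the cone** (`IsZf.inCone`: the seeds by `IsZe.inCone` and the cycle theorem,
the operations by the landed closure lemmas `inCone_sixVec_pendant`, `inCone_sixVec_glue`, `ZoneEmb.sixVec_eq`),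
hence satisfies (P), the one-anchor (CS) and the ZONE O-CUBE (`IsZf.K4_counts`, `IsZf.zoneCSConj`,
`IsZf.zoneOCubeConj`): a block–cut tree of marked points and marked two-exit cycles, hung and glued in any way,
satisfies mine-3's CONJECTURE (ZONE O-CUBE).
-/

namespace PercRepro

namespace ZoneZ

open ZoneData TreeClosure Finset TwoExit PointZone

/-- THE CLASS WITH MARKED CYCLES: the members of `IsZe` and the marked two-exit cycles, closed under pendant
attachment, anchor gluing and the addition or removal of stray vertices. -/
inductive IsZf : {V E T₁ T₂ : Type} → ZoneData V E T₁ T₂ → V → Prop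
  /-- every member of the class `IsZe` -/
  | ofZe {V E T₁ T₂ : Type} (Z : ZoneData V E T₁ T₂) (k : V) : IsZe Z k → IsZf Z k
  /-- the cycle `C_{n+1}` through the anchor with `p` / `q` marks at `x_i` and `p'` / `q'` marks at `x_j`, `0 < i < j` -/
  | cycle (n : ℕ) (i j : Fin (n + 1)) (hi : 0 < i.val) (hij : i.val < j.val) (p q p' q' : ℕ) :
      IsZf (cyc2 n i j (pointZone p q) () (pointZone p' q') ()) (Sum.inl (Sum.inl 0))
  /-- a member hung at any vertex of any unmarked multigraph, anchored anywhere in the latter -/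
  | pendant {V₁ E₁ U₁ U₂ V₂ E₂ T₁ T₂ : Type} (Z₁ : ZoneData V₁ E₁ U₁ U₂) (u a : V₁) (Z₂ : ZoneData V₂ E₂ T₁ T₂)
      (a₂ : V₂) : IsZf Z₂ a₂ → IsZf (Pendant.pendant Z₁ u Z₂ a₂) (Sum.inl a)
  /-- two members glued at their anchors -/
  | glue {V₂ E₂ S₁ S₂ V₃ E₃ R₁ R₂ : Type} (Z₂ : ZoneData V₂ E₂ S₁ S₂) (a₂ : V₂) (Z₃ : ZoneData V₃ E₃ R₁ R₂)
      (a₃ : V₃) : IsZf Z₂ a₂ → IsZf Z₃ a₃ → IsZf (AnchorGlue.glue Z₂ a₂ Z₃ a₃) (Sum.inl a₂)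
  /-- a member with stray vertices added (the target of an embedding) -/
  | embUp {V E T₁ T₂ V' E' T₁' T₂' : Type} {Z : ZoneData V E T₁ T₂} {Z' : ZoneData V' E' T₁' T₂'} (k : V)
      (φ : ZoneEmb Z Z') : IsZf Z k → IsZf Z' (φ.v k)
  /-- a member with stray vertices removed (the source of an embedding) -/
  | embDown {V E T₁ T₂ V' E' T₁' T₂' : Type} {Z : ZoneData V E T₁ T₂} {Z' : ZoneData V' E' T₁' T₂'} (k : V)
      (φ : ZoneEmb Z Z') : IsZf Z' (φ.v k) → IsZf Z k

/-- An isomorphic copy of a member is a member. -/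
theorem IsZf.iso {V E T₁ T₂ V' E' T₁' T₂' : Type} {Z : ZoneData V E T₁ T₂} {Z' : ZoneData V' E' T₁' T₂'} (k : V)
    (φ : ZoneIso Z Z') (h : IsZf Z k) : IsZf Z' (φ.v k) :=
  IsZf.embUp k (ZoneEmb.ofIso φ) h

/-- The triangle host is the cycle `C₃`. -/
theorem tri_eq_cyc : tri = cyc 2 := by
  unfold tri cyc
  congr 1 <;> funext i <;> fin_cases i <;> rfl

/-- The triangle with two marked vertices is a member (`n = 2`, exits `1 < 2`). -/
theorem IsZf.tri2_point (p q p' q' : ℕ) :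
    IsZf (tri2 (pointZone p q) () (pointZone p' q') ()) (Sum.inl (Sum.inl 0)) := by
  unfold tri2
  rw [tri_eq_cyc]
  exact IsZf.cycle 2 1 2 (by decide) (by decide) p q p' q'

/-- **THE SIX-VECTOR OF EVERY MEMBER LIES IN THE CONE**, for every choice of the finiteness instances. -/
theorem IsZf.inCone {V E T₁ T₂ : Type} {Z : ZoneData V E T₁ T₂} {k : V} (h : IsZf Z k) :
    ∀ (iE : Fintype E) (dE : DecidableEq E) (i₁ : Fintype T₁) (d₁ : DecidableEq T₁) (i₂ : Fintype T₂)
      (d₂ : DecidableEq T₂), InCone (@sixVec V E T₁ T₂ Z k iE dE i₁ d₁ i₂ d₂) := by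
  induction h with
  | ofZe Z k h =>
    intro iE dE i₁ d₁ i₂ d₂
    exact h.inCone iE dE i₁ d₁ i₂ d₂
  | cycle n i j hi hij p q p' q' =>
    intro iE dE i₁ d₁ i₂ d₂
    convert inCone_sixVec_cyc2_point n i j hi hij p q p' q'
  | @pendant V₁ E₁ U₁ U₂ V₂ E₂ T₁ T₂ Z₁ u a Z₂ a₂ _ ih =>
    intro iE dE i₁ d₁ i₂ d₂
    haveI : Finite (E₁ ⊕ E₂) := Finite.of_fintype _
    haveI hf₁ : Finite E₁ := Finite.of_injective (Sum.inl : E₁ → E₁ ⊕ E₂) Sum.inl_injective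
    haveI hf₂ : Finite E₂ := Finite.of_injective (Sum.inr : E₂ → E₁ ⊕ E₂) Sum.inr_injective
    letI jE₁ : Fintype E₁ := Fintype.ofFinite E₁
    letI jE₂ : Fintype E₂ := Fintype.ofFinite E₂
    letI eE₁ : DecidableEq E₁ := Classical.decEq E₁
    letI eE₂ : DecidableEq E₂ := Classical.decEq E₂
    cases Subsingleton.elim iE (@instFintypeSum E₁ E₂ jE₁ jE₂)
    cases Subsingleton.elim dE (@instDecidableEqSum E₁ E₂ eE₁ eE₂)
    exact Pendant.inCone_sixVec_pendant Z₁ u Z₂ a₂ a (ih jE₂ eE₂ i₁ d₁ i₂ d₂)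
  | @glue V₂ E₂ S₁ S₂ V₃ E₃ R₁ R₂ Z₂ a₂ Z₃ a₃ _ _ ih₂ ih₃ =>
    intro iE dE i₁ d₁ i₂ d₂
    haveI : Finite (E₂ ⊕ E₃) := Finite.of_fintype _
    haveI : Finite (S₁ ⊕ R₁) := Finite.of_fintype _
    haveI : Finite (S₂ ⊕ R₂) := Finite.of_fintype _
    haveI : Finite E₂ := Finite.of_injective (Sum.inl : E₂ → E₂ ⊕ E₃) Sum.inl_injective
    haveI : Finite E₃ := Finite.of_injective (Sum.inr : E₃ → E₂ ⊕ E₃) Sum.inr_injective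
    haveI : Finite S₁ := Finite.of_injective (Sum.inl : S₁ → S₁ ⊕ R₁) Sum.inl_injective
    haveI : Finite R₁ := Finite.of_injective (Sum.inr : R₁ → S₁ ⊕ R₁) Sum.inr_injective
    haveI : Finite S₂ := Finite.of_injective (Sum.inl : S₂ → S₂ ⊕ R₂) Sum.inl_injective
    haveI : Finite R₂ := Finite.of_injective (Sum.inr : R₂ → S₂ ⊕ R₂) Sum.inr_injective
    letI jE₂ : Fintype E₂ := Fintype.ofFinite E₂
    letI jE₃ : Fintype E₃ := Fintype.ofFinite E₃
    letI jS₁ : Fintype S₁ := Fintype.ofFinite S₁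
    letI jR₁ : Fintype R₁ := Fintype.ofFinite R₁
    letI jS₂ : Fintype S₂ := Fintype.ofFinite S₂
    letI jR₂ : Fintype R₂ := Fintype.ofFinite R₂
    letI eE₂ : DecidableEq E₂ := Classical.decEq E₂
    letI eE₃ : DecidableEq E₃ := Classical.decEq E₃
    letI eS₁ : DecidableEq S₁ := Classical.decEq S₁
    letI eR₁ : DecidableEq R₁ := Classical.decEq R₁
    letI eS₂ : DecidableEq S₂ := Classical.decEq S₂
    letI eR₂ : DecidableEq R₂ := Classical.decEq R₂
    cases Subsingleton.elim iE (@instFintypeSum E₂ E₃ jE₂ jE₃)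
    cases Subsingleton.elim dE (@instDecidableEqSum E₂ E₃ eE₂ eE₃)
    cases Subsingleton.elim i₁ (@instFintypeSum S₁ R₁ jS₁ jR₁)
    cases Subsingleton.elim d₁ (@instDecidableEqSum S₁ R₁ eS₁ eR₁)
    cases Subsingleton.elim i₂ (@instFintypeSum S₂ R₂ jS₂ jR₂)
    cases Subsingleton.elim d₂ (@instDecidableEqSum S₂ R₂ eS₂ eR₂)
    exact AnchorGlue.inCone_sixVec_glue Z₂ a₂ Z₃ a₃ (ih₂ jE₂ eE₂ jS₁ eS₁ jS₂ eS₂) (ih₃ jE₃ eE₃ jR₁ eR₁ jR₂ eR₂)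
  | @embUp V E T₁ T₂ V' E' T₁' T₂' Z Z' k φ _ ih =>
    intro iE dE i₁ d₁ i₂ d₂
    haveI : Finite E' := Finite.of_fintype _
    haveI : Finite T₁' := Finite.of_fintype _
    haveI : Finite T₂' := Finite.of_fintype _
    haveI : Finite E := Finite.of_injective φ.e φ.e.injective
    haveI : Finite T₁ := Finite.of_injective φ.t₁ φ.t₁.injective
    haveI : Finite T₂ := Finite.of_injective φ.t₂ φ.t₂.injective
    letI jE : Fintype E := Fintype.ofFinite E
    letI j₁ : Fintype T₁ := Fintype.ofFinite T₁
    letI j₂ : Fintype T₂ := Fintype.ofFinite T₂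
    letI eE : DecidableEq E := Classical.decEq E
    letI e₁ : DecidableEq T₁ := Classical.decEq T₁
    letI e₂ : DecidableEq T₂ := Classical.decEq T₂
    rw [ZoneEmb.sixVec_eq φ k]
    exact ih jE eE j₁ e₁ j₂ e₂
  | @embDown V E T₁ T₂ V' E' T₁' T₂' Z Z' k φ _ ih =>
    intro iE dE i₁ d₁ i₂ d₂
    haveI : Finite E := Finite.of_fintype _
    haveI : Finite T₁ := Finite.of_fintype _
    haveI : Finite T₂ := Finite.of_fintype _
    haveI : Finite E' := Finite.of_injective φ.e.symm φ.e.symm.injective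
    haveI : Finite T₁' := Finite.of_injective φ.t₁.symm φ.t₁.symm.injective
    haveI : Finite T₂' := Finite.of_injective φ.t₂.symm φ.t₂.symm.injective
    letI jE : Fintype E' := Fintype.ofFinite E'
    letI j₁ : Fintype T₁' := Fintype.ofFinite T₁'
    letI j₂ : Fintype T₂' := Fintype.ofFinite T₂'
    letI eE : DecidableEq E' := Classical.decEq E'
    letI e₁ : DecidableEq T₁' := Classical.decEq T₁'
    letI e₂ : DecidableEq T₂' := Classical.decEq T₂'
    rw [← ZoneEmb.sixVec_eq φ k]
    exact ih jE eE j₁ e₁ j₂ e₂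

/-- **THE INVARIANT (P) ON THE CLASS.** -/
theorem IsZf.K4_counts {V E T₁ T₂ : Type} {Z : ZoneData V E T₁ T₂} {k : V} (h : IsZf Z k) [Fintype E]
    [DecidableEq E] [Fintype T₁] [DecidableEq T₁] [Fintype T₂] [DecidableEq T₂] :
    K4 (#(Z.Fset k) : ℝ) (#(Z.T1set k)) (#(Z.T2set k)) (#(Z.Iset k)) :=
  Z.K4_of_inCone_sixVec k (h.inCone _ _ _ _ _ _)

/-- **THE ONE-ANCHOR (CS) ON THE CLASS.** -/
theorem IsZf.zoneCSConj {V E T₁ T₂ : Type} {Z : ZoneData V E T₁ T₂} {k : V} (h : IsZf Z k) [Fintype E]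
    [DecidableEq E] [Fintype T₁] [DecidableEq T₁] [Fintype T₂] [DecidableEq T₂] :
    Z.ZoneCSConj {k} (∅ : Set V) :=
  Z.zoneCSConj_of_inCone_sixVec k (h.inCone _ _ _ _ _ _)

/-- **THE ZONE O-CUBE ON THE CLASS WITH MARKED CYCLES** — mine-3's CONJECTURE (ZONE O-CUBE) is a theorem on every
zone generated from the one-vertex zones AND the cycles with two marked vertices by hanging at vertices of unmarked
multigraphs, gluing at the anchor, and adding or removing stray vertices. -/
theorem IsZf.zoneOCubeConj {V E T₁ T₂ : Type} {Z : ZoneData V E T₁ T₂} {k : V} (h : IsZf Z k) [Fintype E]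
    [DecidableEq E] [Fintype T₁] [DecidableEq T₁] [Fintype T₂] [DecidableEq T₂] :
    Z.ZoneOCubeConj {k} (∅ : Set V) :=
  Z.zoneOCubeConj_of_inCone_sixVec k (h.inCone _ _ _ _ _ _)

/-- **The cycle operation on the class, modulo the triangle**: for two members at the exits, every two-exit cycle
is in the cone — hence satisfies the ZONE O-CUBE — as soon as the triangle on the same two zones is in the cone
(mine-3's CONJECTURE (CONE) for the triangle is exactly the missing hypothesis). -/
theorem IsZf.inCone_cyc2_of_tri2 (n : ℕ) (i j : Fin (n + 1)) (hi : 0 < i.val) (hij : i.val < j.val)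
    {V E T₁ T₂ V' E' T₁' T₂' : Type} {Z : ZoneData V E T₁ T₂} {a : V} {Z' : ZoneData V' E' T₁' T₂'} {a' : V'}
    [Fintype E] [DecidableEq E] [Fintype T₁] [DecidableEq T₁] [Fintype T₂] [DecidableEq T₂] [Fintype E']
    [DecidableEq E'] [Fintype T₁'] [DecidableEq T₁'] [Fintype T₂'] [DecidableEq T₂'] (h : IsZf Z a)
    (h' : IsZf Z' a') (ht : InCone ((tri2 Z a Z' a').sixVec (Sum.inl (Sum.inl 0)))) :
    InCone ((cyc2 n i j Z a Z' a').sixVec (Sum.inl (Sum.inl 0))) :=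
  inCone_sixVec_cyc2_of_tri2 n i j Z a Z' a' hi hij (h.inCone _ _ _ _ _ _) (h'.inCone _ _ _ _ _ _) ht

end ZoneZ

end PercRepro
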